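import Summits.CriticalPhenomena.PercolationContinuityZ3.Theorems.PercNearOneGluingAdditiveGluingS5Assembly
import Summits.CriticalPhenomena.PercolationContinuityZ3.Theorems.PercNearOneGluingAdditiveGluingGenOfSurplusTransfer
import Summits.CriticalPhenomena.PercolationContinuityZ3.Theorems.PercNearOneGluingAdditiveGluingOfAGloc
import Summits.CriticalPhenomena.PercolationContinuityZ3.Theorems.PercNearOneGluingNoHeavyLowerTailOfAdditiveGluing
import Literature.StrongHypotheses.CriticalPhenomena
import HarnessLib

/-!
# Kozma–Nitzan's Conjectures 1 and 3 (all relay sets) from the surplus-transfer inequality (S5)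

Glue file (`--supports stmt-CriticalPhenomena-4575`), prover `prim-ineq-gen-6` (gen 8).  No definitions, no named facts, no sorries; standard axioms.

The tree reduces the cruxes `AdditiveGluing` (stmt-4576) and `NoHeavyLowerTail` (stmt-4575) to the surplus-transfer inequality (S5)
(`AGloc.additiveGluing_of_surplusTransfer`, `CSH.additiveGluing_of_surplusTransfer_nondegenerate`, `CSH.additiveGluing_of_s5dMargin_nondegenerate`,
`noHeavyLowerTail_of_additiveGluing`).  Kozma–Nitzan's CONJECTURE 1 itself (`Literature…KozmaNitzan2024_conjecture1`, arXiv:2401.12397 p. 3: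
`P(0 ↔ b) ≥ P(0 ↔ A)·min_a P(a ↔ b)`) is STRONGER than `AdditiveGluing` and does not follow from it; it follows from the master form (GEN)
(`AGloc.gen_firstRank_of_surplusTransfer`) with `F = 1{b ∈ ·}`: `P(o ↔ b) ≥ P(o ↔ b, o ↔ A) ≥ Σ_a μ(P_a)·P(a ↔ b) ≥ P(o ↔ A)·t`.  This file
records that chain so that the (S5)_r programme (prim-hp-8 PROOF-S5-ALL-R.md; Lean socket pieces P5–P7) closes, besides the two cruxes, the
registered conjectures `KozmaNitzan2024_conjecture1` and `KozmaNitzan2024_conjecture3` by one-line applications: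

* `AGloc.gen_of_surplusTransfer` — (S5) for all relay sets ⟹ (GEN) for all relay sets (the tree's graded theorem with the grading removed);
* `kozmaNitzan2024_conjecture1_of_gen`, `…_of_surplusTransfer`, `…_of_surplusTransfer_nondegenerate`, `…_of_s5dMargin_nondegenerate`
  (the last with EXACTLY the hypothesis of png-lead's socket `CSH.additiveGluing_of_s5dMargin_nondegenerate`);
* the same four for `KozmaNitzan2024_conjecture3` (via the tree's `kozmaNitzan2024_conjecture3_of_conjecture1`).
[cite: KozmaNitzan2024, Conj. 1 (p. 3), Conj. 3 (p. 15), Conj. 4 (p. 32)]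
-/

noncomputable section

namespace Summit.CriticalPhenomena.PercolationContinuityZ3.Theorems

open MeasureTheory Set
open Literature.Probability.LatticeModels (prodBernoulli)
open Literature.Probability.Percolation
open scoped Classical

/-- **(S5) for every relay set ⟹ (GEN) for every relay set** (`AGloc.gen_firstRank_of_surplusTransfer` with the size grading removed):
`Σ_{a ∈ A} μ(P_a)·m_a ≤ ∫_{o ↔ A} F(C(o))` for every monotone nonnegative `F` and every injective `m`-compatible rank.
[cite: KozmaNitzan2024, Conj. 4 (p. 32)] -/
theorem AGloc.gen_of_surplusTransfer
    (hS5 : ∀ (n : ℕ) (w : Sym2 (Fin n) → unitInterval) (T : Finset (Fin n)) (o v : Fin n) (F : Set (Fin n) → ℝ) (r : Fin n → ℕ),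
      v ∉ T → (∀ S S' : Set (Fin n), S ⊆ S' → F S ≤ F S') → (∀ S, 0 ≤ F S) → Set.InjOn r ↑T →
      (∀ a ∈ T, ∀ a' ∈ T, r a < r a' →
        ∫ ω, F (openCluster ω a) ∂(prodBernoulli w) ≤ ∫ ω, F (openCluster ω a') ∂(prodBernoulli w)) →
      (prodBernoulli w).real ({ω : BondConfig (Fin n) | ∀ a ∈ T, ¬ (openGraph ω).Reachable v a} ∩ openConn o v) *
          (∫ ω in (⋃ a ∈ T, openConn v a), F (openCluster ω v) ∂(prodBernoulli w) -
            ∑ a ∈ T, (prodBernoulli w).real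
                (openConn v a ∩ ⋂ a' ∈ T.filter (fun a' => r a' < r a), (openConn v a')ᶜ : Set (BondConfig (Fin n))) *
              ∫ ω, F (openCluster ω a) ∂(prodBernoulli w)) ≤
        (prodBernoulli w).real {ω : BondConfig (Fin n) | ∀ a ∈ T, ¬ (openGraph ω).Reachable v a} *
          (∫ ω in (⋃ a ∈ T, openConn o a), F (openCluster ω o) ∂(prodBernoulli w) -
            ∑ a ∈ T, (prodBernoulli w).real
                (openConn o a ∩ ⋂ a' ∈ T.filter (fun a' => r a' < r a), (openConn o a')ᶜ : Set (BondConfig (Fin n))) *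
              ∫ ω, F (openCluster ω a) ∂(prodBernoulli w))) :
    ∀ (n : ℕ) (w : Sym2 (Fin n) → unitInterval) (A : Finset (Fin n)) (o : Fin n) (F : Set (Fin n) → ℝ) (r : Fin n → ℕ),
      (∀ S S' : Set (Fin n), S ⊆ S' → F S ≤ F S') → (∀ S, 0 ≤ F S) → Set.InjOn r ↑A →
      (∀ a ∈ A, ∀ a' ∈ A, r a < r a' →
        ∫ ω, F (openCluster ω a) ∂(prodBernoulli w) ≤ ∫ ω, F (openCluster ω a') ∂(prodBernoulli w)) →
      ∑ a ∈ A, (prodBernoulli w).real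
            (openConn o a ∩ ⋂ a' ∈ A.filter (fun a' => r a' < r a), (openConn o a')ᶜ : Set (BondConfig (Fin n))) *
          ∫ ω, F (openCluster ω a) ∂(prodBernoulli w) ≤
        ∫ ω in (⋃ a ∈ A, openConn o a), F (openCluster ω o) ∂(prodBernoulli w) := by
  intro n w A o F r hF hF0 hr hcompat
  rcases Nat.eq_zero_or_pos A.card with h0 | hpos
  · rw [Finset.card_eq_zero.1 h0]
    simp
  · obtain ⟨K, hK⟩ : ∃ K, A.card = K + 1 := ⟨A.card - 1, by omega⟩
    exact AGloc.gen_firstRank_of_surplusTransfer K (fun n w T o v F r _ => hS5 n w T o v F r) n w A o F r hK.le hF hF0 hr hcompat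

/-- **(GEN) for every relay set ⟹ Kozma–Nitzan Conjecture 1** (`P(o ↔ A)·t ≤ P(o ↔ b)` whenever `t ≤ P(a ↔ b)` for all `a ∈ A`): apply (GEN)
to `F = 1{b ∈ ·}` with a `P(· ↔ b)`-compatible injective rank; the first-in-rank patterns partition `{o ↔ A}`, so
`P(o ↔ b) ≥ P(o ↔ A, o ↔ b) ≥ Σ_a μ(P_a)·P(a ↔ b) ≥ t·Σ_a μ(P_a) = t·P(o ↔ A)`. [cite: KozmaNitzan2024, Conj. 1 (p. 3), Conj. 4 (p. 32)] -/
theorem kozmaNitzan2024_conjecture1_of_gen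
    (hgen : ∀ (n : ℕ) (w : Sym2 (Fin n) → unitInterval) (A : Finset (Fin n)) (o : Fin n) (F : Set (Fin n) → ℝ) (r : Fin n → ℕ),
      (∀ S S' : Set (Fin n), S ⊆ S' → F S ≤ F S') → (∀ S, 0 ≤ F S) → Set.InjOn r ↑A →
      (∀ a ∈ A, ∀ a' ∈ A, r a < r a' →
        ∫ ω, F (openCluster ω a) ∂(prodBernoulli w) ≤ ∫ ω, F (openCluster ω a') ∂(prodBernoulli w)) →
      ∑ a ∈ A, (prodBernoulli w).real
            (openConn o a ∩ ⋂ a' ∈ A.filter (fun a' => r a' < r a), (openConn o a')ᶜ : Set (BondConfig (Fin n))) *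
          ∫ ω, F (openCluster ω a) ∂(prodBernoulli w) ≤
        ∫ ω in (⋃ a ∈ A, openConn o a), F (openCluster ω o) ∂(prodBernoulli w)) :
    Literature.StrongHypotheses.CriticalPhenomena.KozmaNitzan2024_conjecture1 := by
  intro n w A o b t ht
  classical
  set μ := prodBernoulli w with hμ
  have hmeas : ∀ S : Set (BondConfig (Fin n)), MeasurableSet S := fun S => (Set.toFinite S).measurableSet
  -- the set function `F = 1{b ∈ ·}`
  set F : Set (Fin n) → ℝ := fun M => if b ∈ M then 1 else 0 with hFdef
  have hFmono : ∀ S T : Set (Fin n), S ⊆ T → F S ≤ F T := by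
    intro S T hST
    simp only [hFdef]
    by_cases hS : b ∈ S
    · rw [if_pos hS, if_pos (hST hS)]
    · rw [if_neg hS]
      split_ifs <;> norm_num
  have hF0 : ∀ S, 0 ≤ F S := by
    intro S
    simp only [hFdef]
    split_ifs <;> norm_num
  have hFind : ∀ x : Fin n, (fun ω : BondConfig (Fin n) => F (openCluster ω x)) =
      (openConn x b : Set (BondConfig (Fin n))).indicator 1 := by
    intro x
    funext ω
    simp only [hFdef]
    by_cases hω : ω ∈ (openConn x b : Set (BondConfig (Fin n)))
    · rw [Set.indicator_of_mem hω, Pi.one_apply, if_pos (show b ∈ openCluster ω x from hω)]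
    · rw [Set.indicator_of_notMem hω, if_neg (show b ∉ openCluster ω x from hω)]
  have hint : ∀ x : Fin n, ∫ ω, F (openCluster ω x) ∂μ = μ.real (openConn x b) := by
    intro x
    rw [hFind x, integral_indicator_one (hmeas _)]
  have hsetint : ∫ ω in (⋃ a ∈ A, openConn o a), F (openCluster ω o) ∂μ =
      μ.real ((⋃ a ∈ A, openConn o a) ∩ openConn o b : Set (BondConfig (Fin n))) := by
    rw [hFind o, ← integral_indicator (hmeas _), Set.indicator_indicator, integral_indicator_one ((hmeas _).inter (hmeas _))]
  -- a reliability-compatible injective rank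
  obtain ⟨r, hr, hrc⟩ := AGloc.exists_rank_compat A (fun a => μ.real (openConn a b))
  have hcompat : ∀ a ∈ A, ∀ a' ∈ A, r a < r a' →
      ∫ ω, F (openCluster ω a) ∂μ ≤ ∫ ω, F (openCluster ω a') ∂μ := by
    intro a ha a' ha' hlt
    rw [hint a, hint a']
    exact hrc a ha a' ha' hlt
  have key := hgen n w A o F r hFmono hF0 hr hcompat
  rw [← hμ] at key
  simp only [hint] at key
  rw [hsetint] at key
  -- `Σ_a μ(P_a)·μ(a ↔ b) ≥ t·Σ_a μ(P_a) = t·μ(o ↔ A)`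
  have hsum := AGloc.sum_measureReal_firstRank w A r o hr
  rw [← hμ] at hsum
  have hlow : ∑ a ∈ A, μ.real (openConn o a ∩ ⋂ a' ∈ A.filter (fun a' => r a' < r a), (openConn o a')ᶜ : Set (BondConfig (Fin n))) * t ≤
      ∑ a ∈ A, μ.real (openConn o a ∩ ⋂ a' ∈ A.filter (fun a' => r a' < r a), (openConn o a')ᶜ : Set (BondConfig (Fin n))) *
        μ.real (openConn a b) :=
    Finset.sum_le_sum fun a ha => mul_le_mul_of_nonneg_left (ht a ha) measureReal_nonneg
  rw [← Finset.sum_mul, hsum] at hlow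
  -- `μ(o ↔ A, o ↔ b) ≤ μ(o ↔ b)`
  have hup : μ.real ((⋃ a ∈ A, openConn o a) ∩ openConn o b : Set (BondConfig (Fin n))) ≤ μ.real (openConn o b) :=
    measureReal_mono Set.inter_subset_right (measure_ne_top _ _)
  linarith [key, hlow, hup]

/-- **(S5) for every relay set (all weights) ⟹ Kozma–Nitzan Conjecture 1.** [cite: KozmaNitzan2024, Conj. 1 (p. 3), Conj. 4 (p. 32)] -/
theorem kozmaNitzan2024_conjecture1_of_surplusTransfer
    (hS5 : ∀ (n : ℕ) (w : Sym2 (Fin n) → unitInterval) (T : Finset (Fin n)) (o v : Fin n) (F : Set (Fin n) → ℝ) (r : Fin n → ℕ),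
      v ∉ T → (∀ S S' : Set (Fin n), S ⊆ S' → F S ≤ F S') → (∀ S, 0 ≤ F S) → Set.InjOn r ↑T →
      (∀ a ∈ T, ∀ a' ∈ T, r a < r a' →
        ∫ ω, F (openCluster ω a) ∂(prodBernoulli w) ≤ ∫ ω, F (openCluster ω a') ∂(prodBernoulli w)) →
      (prodBernoulli w).real ({ω : BondConfig (Fin n) | ∀ a ∈ T, ¬ (openGraph ω).Reachable v a} ∩ openConn o v) *
          (∫ ω in (⋃ a ∈ T, openConn v a), F (openCluster ω v) ∂(prodBernoulli w) -
            ∑ a ∈ T, (prodBernoulli w).real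
                (openConn v a ∩ ⋂ a' ∈ T.filter (fun a' => r a' < r a), (openConn v a')ᶜ : Set (BondConfig (Fin n))) *
              ∫ ω, F (openCluster ω a) ∂(prodBernoulli w)) ≤
        (prodBernoulli w).real {ω : BondConfig (Fin n) | ∀ a ∈ T, ¬ (openGraph ω).Reachable v a} *
          (∫ ω in (⋃ a ∈ T, openConn o a), F (openCluster ω o) ∂(prodBernoulli w) -
            ∑ a ∈ T, (prodBernoulli w).real
                (openConn o a ∩ ⋂ a' ∈ T.filter (fun a' => r a' < r a), (openConn o a')ᶜ : Set (BondConfig (Fin n))) *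
              ∫ ω, F (openCluster ω a) ∂(prodBernoulli w))) :
    Literature.StrongHypotheses.CriticalPhenomena.KozmaNitzan2024_conjecture1 :=
  kozmaNitzan2024_conjecture1_of_gen (AGloc.gen_of_surplusTransfer hS5)

/-- **(S5) for every relay set at NON-DEGENERATE weights ⟹ Kozma–Nitzan Conjecture 1** (closure over degenerate weights by png-lead's
`CSH.surplusTransfer_of_nondegenerate`). [cite: KozmaNitzan2024, Conj. 1 (p. 3), Conj. 4 (p. 32)] -/
theorem kozmaNitzan2024_conjecture1_of_surplusTransfer_nondegenerate
    (hS5 : ∀ (n : ℕ) (p : Sym2 (Fin n) → unitInterval), (∀ e, 0 < p e ∧ p e < 1) →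
      ∀ (T : Finset (Fin n)) (o v : Fin n) (F : Set (Fin n) → ℝ) (r : Fin n → ℕ),
      v ∉ T → (∀ S S' : Set (Fin n), S ⊆ S' → F S ≤ F S') → (∀ S, 0 ≤ F S) → Set.InjOn r ↑T →
      (∀ a ∈ T, ∀ a' ∈ T, r a < r a' →
        ∫ ω, F (openCluster ω a) ∂(prodBernoulli p) ≤ ∫ ω, F (openCluster ω a') ∂(prodBernoulli p)) →
      (prodBernoulli p).real ({ω : BondConfig (Fin n) | ∀ a ∈ T, ¬ (openGraph ω).Reachable v a} ∩ openConn o v) *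
          CSH.surplus p T r F v ≤
        (prodBernoulli p).real {ω : BondConfig (Fin n) | ∀ a ∈ T, ¬ (openGraph ω).Reachable v a} * CSH.surplus p T r F o) :
    Literature.StrongHypotheses.CriticalPhenomena.KozmaNitzan2024_conjecture1 :=
  kozmaNitzan2024_conjecture1_of_surplusTransfer fun n w T o v F r hvT hF hF0 hr hcompat =>
    CSH.surplusTransfer_of_nondegenerate T o v F
      (fun p hp r' hr' hc' => hS5 n p hp T o v F r' hvT hF hF0 hr' hc') w r hr hcompat

/-- **The decoy-free (S5D) margin at non-degenerate weights ⟹ Kozma–Nitzan Conjecture 1** — hypothesis VERBATIM that of png-lead's socket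
`CSH.additiveGluing_of_s5dMargin_nondegenerate` (memo PROOF-S5-ALL-R Theorem 2 at `k = 0`, piece P7), so the same theorem that closes
stmt-4576 closes Conjecture 1. [cite: KozmaNitzan2024, Conj. 1 (p. 3), Conj. 4 (p. 32)] -/
theorem kozmaNitzan2024_conjecture1_of_s5dMargin_nondegenerate
    (h : ∀ (n : ℕ) (p : Sym2 (Fin n) → unitInterval), (∀ e, 0 < p e ∧ p e < 1) →
      ∀ (T : Finset (Fin n)) (o v : Fin n) (F : Set (Fin n) → ℝ) (r : Fin n → ℕ),
      o ∉ T → v ∉ T → o ≠ v → (∀ S S' : Set (Fin n), S ⊆ S' → F S ≤ F S') → (∀ S, 0 ≤ F S) → Set.InjOn r ↑T →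
      (∀ a ∈ T, ∀ a' ∈ T, r a < r a' →
        ∫ ω, F (openCluster ω a) ∂(prodBernoulli p) ≤ ∫ ω, F (openCluster ω a') ∂(prodBernoulli p)) →
      0 ≤ CSH.s5dMargin p T r [] o v F) :
    Literature.StrongHypotheses.CriticalPhenomena.KozmaNitzan2024_conjecture1 :=
  kozmaNitzan2024_conjecture1_of_surplusTransfer_nondegenerate fun n p hp T o v F r hvT hF hF0 hr hcompat =>
    CSH.surplusTransfer_nondegenerate_of_s5dMargin p hp T o v F r hvT hr hcompat
      fun hoT hov => h n p hp T o v F r hoT hvT hov hF hF0 hr hcompat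

/-- **… ⟹ Kozma–Nitzan Conjecture 3** (near-one gluing), from Conjecture 1 by the tree's `kozmaNitzan2024_conjecture3_of_conjecture1`.
[cite: KozmaNitzan2024, Conj. 3 (p. 15)] -/
theorem kozmaNitzan2024_conjecture3_of_s5dMargin_nondegenerate
    (h : ∀ (n : ℕ) (p : Sym2 (Fin n) → unitInterval), (∀ e, 0 < p e ∧ p e < 1) →
      ∀ (T : Finset (Fin n)) (o v : Fin n) (F : Set (Fin n) → ℝ) (r : Fin n → ℕ),
      o ∉ T → v ∉ T → o ≠ v → (∀ S S' : Set (Fin n), S ⊆ S' → F S ≤ F S') → (∀ S, 0 ≤ F S) → Set.InjOn r ↑T →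
      (∀ a ∈ T, ∀ a' ∈ T, r a < r a' →
        ∫ ω, F (openCluster ω a) ∂(prodBernoulli p) ≤ ∫ ω, F (openCluster ω a') ∂(prodBernoulli p)) →
      0 ≤ CSH.s5dMargin p T r [] o v F) :
    Literature.Probability.Percolation.KozmaNitzan2024_conjecture3 :=
  Literature.StrongHypotheses.CriticalPhenomena.kozmaNitzan2024_conjecture3_of_conjecture1 (kozmaNitzan2024_conjecture1_of_s5dMargin_nondegenerate h)

/-- **… ⟹ the lower-tail engine `NoHeavyLowerTail` (stmt-4575)**, with the same hypothesis as png-lead's socket for stmt-4576.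
[cite: KozmaNitzan2024, Conj. 3 (p. 15)] -/
theorem noHeavyLowerTail_of_s5dMargin_nondegenerate
    (h : ∀ (n : ℕ) (p : Sym2 (Fin n) → unitInterval), (∀ e, 0 < p e ∧ p e < 1) →
      ∀ (T : Finset (Fin n)) (o v : Fin n) (F : Set (Fin n) → ℝ) (r : Fin n → ℕ),
      o ∉ T → v ∉ T → o ≠ v → (∀ S S' : Set (Fin n), S ⊆ S' → F S ≤ F S') → (∀ S, 0 ≤ F S) → Set.InjOn r ↑T →
      (∀ a ∈ T, ∀ a' ∈ T, r a < r a' →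
        ∫ ω, F (openCluster ω a) ∂(prodBernoulli p) ≤ ∫ ω, F (openCluster ω a') ∂(prodBernoulli p)) →
      0 ≤ CSH.s5dMargin p T r [] o v F) :
    Summit.CriticalPhenomena.PercolationContinuityZ3.Theses.PercNearOneGluingNoHeavy.NoHeavyLowerTail :=
  noHeavyLowerTail_of_additiveGluing (CSH.additiveGluing_of_s5dMargin_nondegenerate h)

end Summit.CriticalPhenomena.PercolationContinuityZ3.Theorems

end
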